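import Literature.Analysis.FluidPDE.PineauVicolRSSHolds
import HarnessLib

/-!
# Pineau–Vicol 2026, Theorem 1.7 by compactness: the extraction along tuned exponents

Analysis/FluidPDE proofs file (theorems only; no definitions, no named facts). The Chae–Wolf
2017, §3 compactness argument for **rotated discretely self-similar** (RDSS, Pineau–Vicol 2026,
(1.13)) Type I classical Navier–Stokes solutions `w_n = pvAnsatz α_n U_n` (profiles `s`-periodic
with periods `2 log c_n`, factors `c_n ↓ 1`, arbitrary speeds `α_n`, common Type I constant
`C₀`), run along **tuned exponents**: for every `μ ≥ 1` one is given `k_n : ℕ` and `m_n : ℤ`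
with `c_n^{k_n} → μ` and `2α_n log(c_n^{k_n}) − 2π m_n → Θ(μ)` (produced by
`PineauVicol2026.exists_tuned_exponents`, `PineauVicolRDSSTuning.lean`). A subsequence of the
`w_n` converges locally uniformly on `(−∞, −1/4] × ℝ³` to a continuous Type I bounded weak
solution `v` with `v(t,x) = μ R(Θ μ) v(μ²t, μ R(−Θ μ) x)` for every `μ ≥ 1` — `w_n` is
rotated-DSS with every factor `c_n^k` and angle `2α_n log(c_n^k)` (`isRotatedDSS_pvAnsatz`), and
rotations about the axis are `2π`-periodic in the angle — and nontrivial at time `−1`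
(Chae–Wolf's Step 1 with rotations). With `Θ ≡ 0` the limit is self-similar: this reduces
Theorem 1.7 of the source to the Liouville theorems for self-similar Type I ancient solutions
(the route the source names on p. 6). NOT here: the tuning arithmetic, the Liouville theorem
for the limit (`ChaeWolf.limit_eq_zero`), the assembly of Theorem 1.7.

## References

* D. Chae, J. Wolf, *Removing discretely self-similar singularities for the 3D Navier–Stokes
  equations*, Comm. PDE 42 (2017) 1359–1374 = arXiv:1610.09464, §3. [ChaeWolf2017RemovingDSS]
* B. Pineau, V. Vicol, *On rotated backwards self-similar solutions of the incompressible 3D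
  Navier–Stokes equations*, arXiv:2607.09619 (2026), (1.13), Remark 1.5, Theorem 1.7, p. 6.
  [PineauVicol2026]
-/

noncomputable section

open Set Filter Function Metric
open _root_.Topology
open scoped NNReal

namespace Literature.Analysis.FluidPDE

namespace PineauVicol2026

/-! ### Rotations about the axis: continuity and periodicity in the angle -/

/-- The orbit map `θ ↦ R_θ z` of a point under the rotations about the axis is continuous
(private copy of the tree's `continuous_rotZ_angle`, kept here with a light import). [folklore] -/
private theorem rdssTuned_continuous_rotZ_angle (z : EuclideanSpace ℝ (Fin 3)) :
    Continuous fun θ : ℝ => rotZ θ z := by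
  -- adapted from Literature/Analysis/FluidPDE/PineauVicolRSSHolds.lean (continuous_rotZ_angle')
  unfold rotZ
  refine (PiLp.continuous_toLp 2 _).comp ?_
  refine continuous_pi fun i => ?_
  have hc : Continuous fun θ : ℝ => Real.cos θ := Real.continuous_cos
  have hs : Continuous fun θ : ℝ => Real.sin θ := Real.continuous_sin
  fin_cases i
  · exact ((hc.mul (continuous_const (y := z 0))).sub
      (hs.mul (continuous_const (y := z 1)))).congr fun θ => by simp
  · exact ((hs.mul (continuous_const (y := z 0))).add
      (hc.mul (continuous_const (y := z 1)))).congr fun θ => by simp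
  · exact (continuous_const (y := z 2)).congr fun θ => by simp

/-- Rotations by convergent angles of a convergent sequence converge: `θ_n → θ₀`, `z_n → z₀`
imply `R_{θ_n} z_n → R_{θ₀} z₀` (isometries; the orbit map `θ ↦ R_θ z₀` is continuous). [folklore] -/
private theorem rdssTuned_tendsto_rotZ {θ : ℕ → ℝ} {θ₀ : ℝ}
    {z : ℕ → EuclideanSpace ℝ (Fin 3)} {z₀ : EuclideanSpace ℝ (Fin 3)}
    (hθ : Tendsto θ atTop (𝓝 θ₀)) (hz : Tendsto z atTop (𝓝 z₀)) :
    Tendsto (fun n => rotZ (θ n) (z n)) atTop (𝓝 (rotZ θ₀ z₀)) := by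
  -- adapted from Literature/Analysis/FluidPDE/PineauVicolRSSHolds.lean (tendsto_rotZ_of_tendsto)
  rw [tendsto_iff_norm_sub_tendsto_zero] at hz ⊢
  have h1 : Tendsto (fun n => rotZ (θ n) z₀) atTop (𝓝 (rotZ θ₀ z₀)) :=
    ((rdssTuned_continuous_rotZ_angle z₀).tendsto θ₀).comp hθ
  have h1' := tendsto_iff_norm_sub_tendsto_zero.1 h1
  have hbound : ∀ n, ‖rotZ (θ n) (z n) - rotZ θ₀ z₀‖ ≤
      ‖z n - z₀‖ + ‖rotZ (θ n) z₀ - rotZ θ₀ z₀‖ := fun n => by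
    calc ‖rotZ (θ n) (z n) - rotZ θ₀ z₀‖
        ≤ ‖rotZ (θ n) (z n) - rotZ (θ n) z₀‖ + ‖rotZ (θ n) z₀ - rotZ θ₀ z₀‖ :=
          norm_sub_le_norm_sub_add_norm_sub _ _ _
      _ = ‖z n - z₀‖ + ‖rotZ (θ n) z₀ - rotZ θ₀ z₀‖ := by
          congr 1
          rw [← rotZL_apply (θ n) (z n), ← rotZL_apply (θ n) z₀, ← map_sub, rotZL_apply,
            norm_rotZ]
  refine squeeze_zero (fun n => norm_nonneg _) hbound ?_
  simpa using hz.add h1'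

/-- Rotations about the axis are `2π`-periodic in the angle: `R(θ − 2πm) = R(θ)` for every
integer `m` (Remark 1.5 of the source, "`R(s + 2π) = R(s)`"). [cite: PineauVicol2026, Remark 1.5 (arXiv:2607.09619 p. 5)] -/
private theorem rdssTuned_rotZ_sub_two_pi_mul (θ : ℝ) (m : ℤ) (x : EuclideanSpace ℝ (Fin 3)) :
    rotZ (θ - 2 * Real.pi * m) x = rotZ θ x := by
  rw [show θ - 2 * Real.pi * m = θ - m * (2 * Real.pi) by ring]
  ext i
  fin_cases i <;> simp [Real.cos_sub_int_mul_two_pi, Real.sin_sub_int_mul_two_pi]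

/-- The inverse rotations are likewise unchanged: `R(−(θ − 2πm)) = R(−θ)`. [folklore] -/
private theorem rdssTuned_rotZ_neg_sub_two_pi_mul (θ : ℝ) (m : ℤ)
    (x : EuclideanSpace ℝ (Fin 3)) : rotZ (-(θ - 2 * Real.pi * m)) x = rotZ (-θ) x := by
  have e : -(θ - 2 * Real.pi * m) = -θ - 2 * Real.pi * ((-m : ℤ) : ℝ) := by push_cast; ring
  rw [e, rdssTuned_rotZ_sub_two_pi_mul]

/-- The RDSS ansatz field with a `2 log c`-periodic profile is rotated-DSS with every factor
`μ = c ^ k`: `w(t,x) = μ R(θ) w(μ²t, μ R(−θ) x)`, `θ = 2α log μ` (a `2 log c`-periodic profile is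
`2 log (c ^ k)`-periodic; the tree's `isRotatedDSS_pvAnsatz`). [cite: PineauVicol2026, (1.13) and Remark 1.5] -/
private theorem rdssTuned_pvAnsatz_eq_smul_rotZ_pow (α : ℝ) {c : ℝ} (hc : 0 < c)
    {U : EuclideanSpace ℝ (Fin 3) → ℝ → EuclideanSpace ℝ (Fin 3)}
    (hper : ∀ (y : EuclideanSpace ℝ (Fin 3)) (s : ℝ), U y (s + 2 * Real.log c) = U y s)
    (k : ℕ) (t : ℝ) (x : EuclideanSpace ℝ (Fin 3)) :
    pvAnsatz α U t x = c ^ k • rotZ (α * (2 * Real.log (c ^ k)))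
      (pvAnsatz α U ((c ^ k) ^ 2 * t) (c ^ k • rotZ (-(α * (2 * Real.log (c ^ k)))) x)) := by
  -- adapted from Literature/Analysis/FluidPDE/PineauVicolRSSHolds.lean (pvAnsatz_rss_eq_smul_rotZ)
  have hperk : ∀ (y : EuclideanSpace ℝ (Fin 3)) (s : ℝ),
      U y (s + 2 * Real.log (c ^ k)) = U y s := fun y s => by
    rw [show s + 2 * Real.log (c ^ k) = s + k * (2 * Real.log c) by rw [Real.log_pow]; ring]
    exact profile_add_nat_mul_period hper y s k
  have h := isRotatedDSS_pvAnsatz (α := α) (pow_pos hc k) hperk t x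
  simp only [rotZLIE_symm_apply, rotZLIE_apply, neg_neg] at h
  exact h.symm

/-- **Chae–Wolf 2017, §3, Step 1, with rotations.** From a point where the scale-invariant size
`√(−t')‖w(t',x')‖ = ‖U(y', s')‖` of the RDSS ansatz field exceeds `ε₀`, the periodicity of the
profile moves the self-similar time `s'` into the period `[−2 log c, 0)`, i.e. to a time
`t ∈ [−c², −1]`, at a rotated and rescaled point of the same size; for `c ≤ 2` the Type I bound
then confines the point to `‖x‖ ≤ 2C₀/ε₀` and gives `‖w(t,x)‖ ≥ ε₀/2`. [cite: ChaeWolf2017RemovingDSS, §3 Step 1 (arXiv:1610.09464 p. 8)] -/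
private theorem rdssTuned_witness {ε₀ C₀ α c : ℝ}
    {U : EuclideanSpace ℝ (Fin 3) → ℝ → EuclideanSpace ℝ (Fin 3)} (hε₀ : 0 < ε₀) (hC₀ : 0 ≤ C₀)
    (hc1 : 1 < c) (hc2 : c ≤ 2)
    (hper : ∀ (y : EuclideanSpace ℝ (Fin 3)) (s : ℝ), U y (s + 2 * Real.log c) = U y s)
    (hI : HasTypeIDecay C₀ (pvAnsatz α U)) {t' : ℝ} (ht' : t' < 0)
    {x' : EuclideanSpace ℝ (Fin 3)} (hq' : ε₀ < √(-t') * ‖pvAnsatz α U t' x'‖) :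
    ∃ t ∈ Icc (-c ^ 2) (-1), ∃ x : EuclideanSpace ℝ (Fin 3),
      ‖x‖ ≤ 2 * C₀ / ε₀ ∧ ε₀ / 2 ≤ ‖pvAnsatz α U t x‖ := by
  -- adapted from Literature/Analysis/FluidPDE/ChaeWolfRemovingDSSLimit.lean (exists_witness)
  have hc0 : 0 < c := one_pos.trans hc1
  have hS : 0 < 2 * Real.log c := mul_pos two_pos (Real.log_pos hc1)
  -- the size in terms of the profile: `√(-t') ‖w t' x'‖ = ‖U y' s'‖`
  have hs' : 0 < √(-t') := Real.sqrt_pos.2 (by linarith)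
  set y' : EuclideanSpace ℝ (Fin 3) :=
    rotZ (-(α * -Real.log (-t'))) ((√(-t'))⁻¹ • x') with hy'
  have hUy : ε₀ < ‖U y' (-Real.log (-t'))‖ := by
    have e : √(-t') * ‖pvAnsatz α U t' x'‖ = ‖U y' (-Real.log (-t'))‖ := by
      rw [norm_pvAnsatz, ← mul_assoc, mul_inv_cancel₀ hs'.ne', one_mul]
    rwa [e] at hq'
  -- move the self-similar time into the period `[-2 log c, 0)`
  have hP : Function.Periodic (fun s => U y' s) (2 * Real.log c) := fun s => hper y' s
  obtain ⟨s, hs, hUs⟩ := hP.exists_mem_Ico hS (-Real.log (-t')) (-(2 * Real.log c))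
  rw [neg_add_cancel] at hs
  have hUs' : U y' (-Real.log (-t')) = U y' s := hUs
  set t : ℝ := -Real.exp (-s) with ht
  have hlog : -Real.log (-t) = s := by rw [ht, neg_neg, Real.log_exp, neg_neg]
  have hr : 0 < √(-t) := Real.sqrt_pos.2 (by rw [ht, neg_neg]; exact Real.exp_pos _)
  have htI : t ∈ Icc (-c ^ 2) (-1) := by
    have h1 : Real.exp (-s) ≤ c ^ 2 := by
      rw [← Real.exp_log (pow_pos hc0 2), Real.exp_le_exp, Real.log_pow]
      push_cast
      linarith [hs.1]
    have h2 : 1 ≤ Real.exp (-s) := Real.one_le_exp_iff.2 (by linarith [hs.2])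
    exact ⟨by linarith [ht, h1], by linarith [ht, h2]⟩
  refine ⟨t, htI, √(-t) • rotZ (α * s) y', ChaeWolf.witness_of_point hε₀ hC₀ hc0.le hc2 hI htI ?_⟩
  rw [norm_pvAnsatz, hlog, inv_smul_smul₀ hr.ne', ← rotZ_add, neg_add_cancel, rotZ_zero,
    ← mul_assoc, mul_inv_cancel₀ hr.ne', one_mul, ← hUs']
  exact hUy

/-! ### The extraction (normalised factors `c_n ≤ 2`) -/

/-- The extraction step below under the harmless normalisation `c_n ≤ 2` (true on a tail of any
sequence `c_n → 1`); see `exists_limit_rdss_tuned` for the statement and the argument. [cite: ChaeWolf2017RemovingDSS, §3 Steps 1–2 (arXiv:1610.09464 pp. 8–9)] -/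
private theorem rdssTuned_exists_limit_of_le_two {C₀ : ℝ} {α c : ℕ → ℝ} {Θ : ℝ → ℝ}
    {U : ℕ → EuclideanSpace ℝ (Fin 3) → ℝ → EuclideanSpace ℝ (Fin 3)}
    {P : ℕ → ℝ → EuclideanSpace ℝ (Fin 3) → ℝ} (hC₀ : 0 < C₀) (hc1 : ∀ n, 1 < c n)
    (hc2 : ∀ n, c n ≤ 2) (hc : Tendsto c atTop (𝓝 1))
    (hper : ∀ (n : ℕ) (y : EuclideanSpace ℝ (Fin 3)) (s : ℝ),
      U n y (s + 2 * Real.log (c n)) = U n y s)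
    (hcl : ∀ n, IsClassicalNSSolutionOn (Iio 0) 1 0 (pvAnsatz (α n) (U n)) (P n))
    (hI : ∀ n, HasTypeIDecay C₀ (pvAnsatz (α n) (U n)))
    (hnt : ∀ n, ∃ t < 0, ∃ x : EuclideanSpace ℝ (Fin 3), pvAnsatz (α n) (U n) t x ≠ 0)
    (htune : ∀ μ : ℝ, 1 ≤ μ → ∃ (k : ℕ → ℕ) (m : ℕ → ℤ),
      Tendsto (fun n => c n ^ k n) atTop (𝓝 μ) ∧
      Tendsto (fun n => α n * (2 * Real.log (c n ^ k n)) - 2 * Real.pi * m n) atTop (𝓝 (Θ μ))) :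
    ∃ v : ℝ → EuclideanSpace ℝ (Fin 3) → EuclideanSpace ℝ (Fin 3), Continuous (uncurry v) ∧
      (∀ t ≤ -(1 / 4 : ℝ), ∀ x, ‖v t x‖ ≤ C₀ / (‖x‖ + √(-t))) ∧
      IsBoundedWeakNSSolutionOn (Iio 0) isOpen_Iio 1 (fun t => v (t - 1 / 4)) ∧
      (∀ μ : ℝ, 1 ≤ μ → ∀ t ≤ -(1 / 4 : ℝ), ∀ x,
        v t x = μ • rotZ (Θ μ) (v (μ ^ 2 * t) (μ • rotZ (-(Θ μ)) x))) ∧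
      ∃ x : EuclideanSpace ℝ (Fin 3), v (-1) x ≠ 0 := by
  -- adapted from Literature/Analysis/FluidPDE/ChaeWolfRemovingDSSLimit.lean (ChaeWolf.exists_limit)
  set w : ℕ → ℝ → EuclideanSpace ℝ (Fin 3) → EuclideanSpace ℝ (Fin 3) :=
    fun n => pvAnsatz (α n) (U n) with hw
  obtain ⟨K, L, hK, hL, hKL⟩ := ChaeWolf.exists_uniform_lipschitz hC₀.le
  obtain ⟨ε₀, hε₀, hA⟩ := ChaeWolf.exists_eps_typeI_small_eq_zero
  -- Step 1: witnesses `t_n ∈ [-c_n², -1]`, `‖x_n‖ ≤ 2C₀/ε₀`, `‖w_n(t_n, x_n)‖ ≥ ε₀/2`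
  have hwit : ∀ n, ∃ t ∈ Icc (-c n ^ 2) (-1), ∃ x : EuclideanSpace ℝ (Fin 3),
      ‖x‖ ≤ 2 * C₀ / ε₀ ∧ ε₀ / 2 ≤ ‖w n t x‖ := by
    intro n
    obtain ⟨t', ht', x', hq'⟩ : ∃ t' < 0, ∃ x', ε₀ < √(-t') * ‖w n t' x'‖ := by
      by_contra hcon
      push Not at hcon
      obtain ⟨t, ht, x, hx⟩ := hnt n
      exact hx (hA hC₀.le (hcl n) (hI n) hcon t ht x)
    exact rdssTuned_witness hε₀ hC₀.le (hc1 n) (hc2 n) (hper n) (hI n) ht' hq'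
  -- the equi-Lipschitz family on `ℝ × ℝ³` (fields frozen at time `-1/4` for later times)
  set Kx : ℝ≥0 := (K + L).toNNReal with hKx
  have hKx' : (Kx : ℝ) = K + L := by rw [hKx, Real.coe_toNNReal _ (by positivity)]
  set f : ℕ → ℝ × EuclideanSpace ℝ (Fin 3) → EuclideanSpace ℝ (Fin 3) :=
    fun n q => w n (min q.1 (-(1 / 4 : ℝ))) q.2 with hf
  have hf_of_le : ∀ n {t : ℝ} (_ : t ≤ -(1 / 4 : ℝ)) (x : EuclideanSpace ℝ (Fin 3)),
      f n (t, x) = w n t x :=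
    fun n t ht x => by simp only [hf, min_eq_left ht]
  have hlip : ∀ n, LipschitzWith Kx (f n) := by
    intro n
    obtain ⟨hsp, htm⟩ := hKL (hcl n) (hI n)
    refine LipschitzWith.of_dist_le_mul fun q q' => ?_
    rw [hKx', dist_eq_norm, Prod.dist_eq, Real.dist_eq, dist_eq_norm]
    have hm : min q.1 (-(1 / 4 : ℝ)) ≤ -(1 / 4 : ℝ) := min_le_right _ _
    have hm' : min q'.1 (-(1 / 4 : ℝ)) ≤ -(1 / 4 : ℝ) := min_le_right _ _
    have hmin : |min q.1 (-(1 / 4 : ℝ)) - min q'.1 (-(1 / 4 : ℝ))| ≤ |q.1 - q'.1| := by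
      refine (abs_min_sub_min_le_max _ _ _ _).trans (max_le le_rfl ?_)
      rw [sub_self, abs_zero]; exact abs_nonneg _
    calc ‖w n (min q.1 (-(1 / 4))) q.2 - w n (min q'.1 (-(1 / 4))) q'.2‖
        ≤ ‖w n (min q.1 (-(1 / 4))) q.2 - w n (min q.1 (-(1 / 4))) q'.2‖ +
            ‖w n (min q.1 (-(1 / 4))) q'.2 - w n (min q'.1 (-(1 / 4))) q'.2‖ :=
          norm_sub_le_norm_sub_add_norm_sub _ _ _
      _ ≤ K * ‖q.2 - q'.2‖ + L * |min q.1 (-(1 / 4 : ℝ)) - min q'.1 (-(1 / 4 : ℝ))| :=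
          add_le_add (hsp _ hm _ _) (htm _ hm' _ hm _)
      _ ≤ K * max |q.1 - q'.1| ‖q.2 - q'.2‖ + L * max |q.1 - q'.1| ‖q.2 - q'.2‖ := by
          gcongr
          · exact le_max_right _ _
          · exact hmin.trans (le_max_left _ _)
      _ = (K + L) * max |q.1 - q'.1| ‖q.2 - q'.2‖ := by ring
  have hball : ∀ n q, f n q ∈ closedBall (0 : EuclideanSpace ℝ (Fin 3)) (2 * C₀) :=
      fun n q => by
    rw [mem_closedBall, dist_zero_right]
    exact ChaeWolf.typeI_norm_le_two_mul hC₀.le (hI n) (min_le_right _ _) _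
  obtain ⟨φ, l, hφ, hl, -, hlim⟩ := exists_strictMono_tendsto_of_lipschitzWith f hlip hball
  -- the limit field
  set v : ℝ → EuclideanSpace ℝ (Fin 3) → EuclideanSpace ℝ (Fin 3) := fun t x => l (t, x) with hv
  have hlimv : ∀ {t : ℝ} (_ : t ≤ -(1 / 4 : ℝ)) (x : EuclideanSpace ℝ (Fin 3)),
      Tendsto (fun n => w (φ n) t x) atTop (𝓝 (v t x)) := by
    intro t ht x
    simpa only [hf_of_le _ ht] using hlim (t, x)
  have hvc : Continuous (uncurry v) := by
    have e : uncurry v = l := by funext q; rfl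
    rw [e]; exact hl.continuous
  refine ⟨v, hvc, ?_, ?_, ?_, ?_⟩
  · -- the Type I bound passes to the limit
    intro t ht x
    exact le_of_tendsto' (hlimv ht x).norm fun n => hI (φ n) t (by linarith) x
  · -- bounded weak solution on `(-∞, -1/4)`, shifted to `(-∞, 0)`
    have hA' : Tendsto (fun k : ℕ => -(k : ℝ) + -1) atTop atBot :=
      (tendsto_neg_atTop_atBot.comp tendsto_natCast_atTop_atTop).atBot_add tendsto_const_nhds
    have e14 : ∀ t : ℝ, t - 1 / 4 = t + -(1 / 4 : ℝ) := fun t => by ring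
    have hV : ∀ k : ℕ, IsBoundedWeakNSSolutionOn (Ioo (-(k : ℝ) + -1) 0) isOpen_Ioo 1
        (fun t => w (φ k) (t - 1 / 4)) := by
      intro k
      have hcl' : IsClassicalNSSolutionOn (Ioo (-(k : ℝ) + -1 + -(1 / 4)) (-(1 / 4))) 1 0
          (w (φ k)) (P (φ k)) :=
        (hcl (φ k)).mono (fun t ht => by simp only [mem_Iio]; linarith [ht.2])
          (uniqueDiffOn_Ioo _ _)
      have hbdd : IsBoundedOn (Ioo (-(k : ℝ) + -1 + -(1 / 4)) (-(1 / 4))) (w (φ k)) :=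
        ⟨2 * C₀, fun t ht x => ChaeWolf.typeI_norm_le_two_mul hC₀.le (hI (φ k)) ht.2.le x⟩
      have h := (hcl'.isBoundedWeakNSSolutionOn hbdd).comp_add_right (-(1 / 4 : ℝ))
        (J := Ioo (-(k : ℝ) + -1) 0) isOpen_Ioo fun t => by
          simp only [mem_Ioo]
          constructor <;> intro h <;> constructor <;> linarith [h.1, h.2]
      simpa only [e14] using h
    have hcont : ∀ k : ℕ, ContinuousOn (uncurry fun t => w (φ k) (t - 1 / 4))
        (Ioo (-(k : ℝ) + -1) 0 ×ˢ univ) := by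
      intro k
      have h1 := ((hcl (φ k)).smooth_velocity.comp_add_right (-(1 / 4 : ℝ))).continuousOn
      refine (h1.mono (prod_mono (fun t ht => ?_) Subset.rfl)).congr fun q _ => by
        simp only [uncurry, e14, hw]
      simp only [mem_preimage, mem_Iio]
      linarith [ht.2]
    have hbd : ∀ k : ℕ, ∀ t ∈ Ioo (-(k : ℝ) + -1) 0, ∀ x,
        ‖w (φ k) (t - 1 / 4) x‖ ≤ 2 * C₀ :=
      fun k t ht x => ChaeWolf.typeI_norm_le_two_mul hC₀.le (hI (φ k)) (by linarith [ht.2]) x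
    have hvc' : Continuous (uncurry fun t x => v (t - 1 / 4) x) :=
      hvc.comp ((continuous_fst.sub continuous_const).prodMk continuous_snd)
    exact isBoundedWeakNSSolutionOn_of_tendsto hA' hV hcont hbd hvc'
      fun t ht x => hlimv (by linarith) x
  · -- twisted scaling law of the limit: `λ_n = c_n ^ k_n → μ`, `2α_n log λ_n - 2πm_n → Θ μ`
    intro μ hμ t ht x
    have ht0 : t ≤ 0 := by linarith
    obtain ⟨k, m, hk, hm⟩ := htune μ hμ
    set lam : ℕ → ℝ := fun n => c n ^ k n with hlam
    have hlam1 : ∀ n, 1 ≤ lam n := fun n => one_le_pow₀ (hc1 n).le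
    have hlamφ : Tendsto (lam ∘ φ) atTop (𝓝 μ) := hk.comp hφ.tendsto_atTop
    set θ : ℕ → ℝ := fun n => α n * (2 * Real.log (lam n)) - 2 * Real.pi * m n with hθ
    have hθlim : Tendsto (fun n => θ (φ n)) atTop (𝓝 (Θ μ)) := hm.comp hφ.tendsto_atTop
    -- the twisted scaling identities along the sequence
    have hid : ∀ n, w n t x =
        lam n • rotZ (θ n) (w n (lam n ^ 2 * t) (lam n • rotZ (-(θ n)) x)) := fun n => by
      simp only [hθ]
      rw [rdssTuned_rotZ_sub_two_pi_mul, rdssTuned_rotZ_neg_sub_two_pi_mul]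
      exact rdssTuned_pvAnsatz_eq_smul_rotZ_pow (α n) (one_pos.trans (hc1 n)) (hper n) (k n) t x
    have hmem : ∀ s : ℝ, 1 ≤ s → s ^ 2 * t ≤ -(1 / 4 : ℝ) := fun s hs =>
      (mul_le_of_one_le_left ht0 (one_le_pow₀ hs)).trans ht
    have hrot : Tendsto (fun n => rotZ (-(θ (φ n))) x) atTop (𝓝 (rotZ (-(Θ μ)) x)) :=
      rdssTuned_tendsto_rotZ hθlim.neg tendsto_const_nhds
    set q : ℕ → ℝ × EuclideanSpace ℝ (Fin 3) :=
      fun n => (lam (φ n) ^ 2 * t, lam (φ n) • rotZ (-(θ (φ n))) x) with hq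
    have hqlim : Tendsto q atTop (𝓝 (μ ^ 2 * t, μ • rotZ (-(Θ μ)) x)) :=
      ((hlamφ.pow 2).mul_const t).prodMk_nhds (hlamφ.smul hrot)
    have h1 : Tendsto (fun n => f (φ n) (q n)) atTop
        (𝓝 (v (μ ^ 2 * t) (μ • rotZ (-(Θ μ)) x))) :=
      ChaeWolf.tendsto_apply_of_tendsto (fun n => hlip (φ n)) hqlim
        (hlim (μ ^ 2 * t, μ • rotZ (-(Θ μ)) x))
    have h1' : Tendsto (fun n => w (φ n) (lam (φ n) ^ 2 * t) (lam (φ n) • rotZ (-(θ (φ n))) x))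
        atTop (𝓝 (v (μ ^ 2 * t) (μ • rotZ (-(Θ μ)) x))) := by
      refine h1.congr fun n => ?_
      simp only [hq, hf_of_le _ (hmem _ (hlam1 _))]
    have h2 := rdssTuned_tendsto_rotZ hθlim h1'
    have h3 : Tendsto (fun n => w (φ n) t x) atTop
        (𝓝 (μ • rotZ (Θ μ) (v (μ ^ 2 * t) (μ • rotZ (-(Θ μ)) x)))) := by
      refine (hlamφ.smul h2).congr fun n => ?_
      exact (hid (φ n)).symm
    exact tendsto_nhds_unique (hlimv ht x) h3
  · -- nontriviality at time `-1`: the witnesses accumulate at a point `(-1, x̄)`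
    choose tw htw xw hxw hnw using hwit
    set S : Set (ℝ × EuclideanSpace ℝ (Fin 3)) :=
      Icc (-4 : ℝ) (-1) ×ˢ closedBall (0 : EuclideanSpace ℝ (Fin 3)) (2 * C₀ / ε₀) with hS
    have hSc : IsCompact S := isCompact_Icc.prod (isCompact_closedBall _ _)
    have hmemS : ∀ n, (tw (φ n), xw (φ n)) ∈ S := fun n => by
      refine mk_mem_prod ⟨?_, (htw (φ n)).2⟩ ?_
      · have : c (φ n) ^ 2 ≤ 4 := by nlinarith [hc2 (φ n), hc1 (φ n)]
        linarith [(htw (φ n)).1]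
      · rw [mem_closedBall, dist_zero_right]; exact hxw (φ n)
    obtain ⟨⟨tbar, xbar⟩, -, ψ, hψ, hconv⟩ := hSc.tendsto_subseq hmemS
    -- the limit time is `-1`
    have ht1 : Tendsto (fun n => tw (φ (ψ n))) atTop (𝓝 (-1)) := by
      have hlow : Tendsto (fun n => -(c (φ (ψ n))) ^ 2) atTop (𝓝 (-1)) := by
        have := ((hc.comp hφ.tendsto_atTop).comp hψ.tendsto_atTop).pow 2
        simpa using this.neg
      exact tendsto_of_tendsto_of_tendsto_of_le_of_le hlow tendsto_const_nhds
        (fun n => (htw _).1) fun n => (htw _).2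
    have htbar : tbar = -1 :=
      tendsto_nhds_unique ((continuous_fst.tendsto _).comp hconv) ht1
    subst htbar
    refine ⟨xbar, fun h0 => ?_⟩
    have h14 : (-1 : ℝ) ≤ -(1 / 4 : ℝ) := by norm_num
    have hy : Tendsto (fun n => f (φ (ψ n)) ((-1 : ℝ), xbar)) atTop (𝓝 (v (-1) xbar)) :=
      (hlim ((-1 : ℝ), xbar)).comp hψ.tendsto_atTop
    have hmain := ChaeWolf.tendsto_apply_of_tendsto (fun n => hlip (φ (ψ n))) hconv hy
    have hge : ε₀ / 2 ≤ ‖v (-1) xbar‖ := by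
      refine ge_of_tendsto' hmain.norm fun n => ?_
      simp only [comp_apply, hf_of_le _ ((htw _).2.trans h14)]
      exact hnw (φ (ψ n))
    rw [h0, norm_zero] at hge
    linarith

/-- **The compactness step for Type I RDSS solutions along tuned exponents (Chae–Wolf 2017, §3,
Steps 1–2, run with rotations and factors `c_n → 1`).** Let `w_n = pvAnsatz α_n U_n` be the RDSS
ansatz fields (1.13a) with speeds `α_n` and `s`-periodic profiles `U_n` of periods `2 log c_n`,
`1 < c_n → 1`, each a classical Navier–Stokes solution (`ν = 1`, `f = 0`) on `ℝ³ × (−∞, 0)`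
obeying the common Type I bound `‖w_n(t,x)‖ ≤ C₀/(‖x‖ + √(−t))` and not identically zero, and
suppose that for every `μ ≥ 1` exponents `k_n : ℕ` and integers `m_n` are given with
`c_n^{k_n} → μ` and `2α_n log(c_n^{k_n}) − 2π m_n → Θ(μ)`. Then a subsequence converges, locally
uniformly on `(−∞, −1/4] × ℝ³` (uniform Lipschitz bounds `ChaeWolf.exists_uniform_lipschitz`,
pointwise Arzelà–Ascoli), to a continuous field `v` with the same Type I bound, a bounded weak
Navier–Stokes solution on `(−∞, −1/4)` (written for `t ↦ v(t − 1/4)` on `(−∞, 0)`) obeying the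
**twisted scaling law with the prescribed angles** `v(t,x) = μ R(Θ μ) v(μ²t, μ R(−Θ μ) x)`,
`μ ≥ 1`: with `λ_n = c_n^{k_n} → μ`, `w_n(t,x) = λ_n R(θ_n) w_n(λ_n²t, λ_n R(−θ_n) x)` for
`θ_n = 2α_n log λ_n − 2π m_n → Θ μ` (`isRotatedDSS_pvAnsatz` at the factor `c_n^{k_n}`,
`R(θ − 2πm) = R(θ)`, equicontinuity, continuity of the rotations in the angle); and
**nontrivial at time `−1`** (on a tail with `c_n ≤ 2`, the smallness lemma
`ChaeWolf.exists_eps_typeI_small_eq_zero`, the size identity `√(−t)|w_n(t,x)| = |U_n(y,s)|`,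
periodicity in `s` and the Type I bound give witnesses `t_n ∈ [−c_n², −1]`, `‖x_n‖ ≤ 2C₀/ε₀`,
`‖w_n(t_n,x_n)‖ ≥ ε₀/2`, accumulating at a point `(−1, x̄)` with `‖v(−1, x̄)‖ ≥ ε₀/2`). [cite: ChaeWolf2017RemovingDSS, §3 Steps 1–2 (arXiv:1610.09464 pp. 8–9); PineauVicol2026, (1.13), Remark 1.5, Theorem 1.7 and p. 6] -/
theorem exists_limit_rdss_tuned {C₀ : ℝ} (hC₀ : 0 < C₀) {α c : ℕ → ℝ} {Θ : ℝ → ℝ}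
    {U : ℕ → EuclideanSpace ℝ (Fin 3) → ℝ → EuclideanSpace ℝ (Fin 3)}
    {P : ℕ → ℝ → EuclideanSpace ℝ (Fin 3) → ℝ}
    (hc : ∀ n, 1 < c n) (hclim : Tendsto c atTop (𝓝 1))
    (hper : ∀ (n : ℕ) (y : EuclideanSpace ℝ (Fin 3)) (s : ℝ),
      U n y (s + 2 * Real.log (c n)) = U n y s)
    (hcl : ∀ n, IsClassicalNSSolutionOn (Iio 0) 1 0 (pvAnsatz (α n) (U n)) (P n))
    (hI : ∀ n, HasTypeIDecay C₀ (pvAnsatz (α n) (U n)))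
    (hnt : ∀ n, ∃ t < 0, ∃ x : EuclideanSpace ℝ (Fin 3), pvAnsatz (α n) (U n) t x ≠ 0)
    (htune : ∀ μ : ℝ, 1 ≤ μ → ∃ (k : ℕ → ℕ) (m : ℕ → ℤ),
      Tendsto (fun n => c n ^ k n) atTop (𝓝 μ) ∧
      Tendsto (fun n => α n * (2 * Real.log (c n ^ k n)) - 2 * Real.pi * m n) atTop (𝓝 (Θ μ))) :
    ∃ v : ℝ → EuclideanSpace ℝ (Fin 3) → EuclideanSpace ℝ (Fin 3), Continuous (uncurry v) ∧
      (∀ t ≤ -(1 / 4 : ℝ), ∀ x, ‖v t x‖ ≤ C₀ / (‖x‖ + √(-t))) ∧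
      IsBoundedWeakNSSolutionOn (Iio 0) isOpen_Iio 1 (fun t => v (t - 1 / 4)) ∧
      (∀ μ : ℝ, 1 ≤ μ → ∀ t ≤ -(1 / 4 : ℝ), ∀ x,
        v t x = μ • rotZ (Θ μ) (v (μ ^ 2 * t) (μ • rotZ (-(Θ μ)) x))) ∧
      ∃ x : EuclideanSpace ℝ (Fin 3), v (-1) x ≠ 0 := by
  -- pass to a tail of the sequence on which `c n ≤ 2` (the conclusion only sees the limits)
  obtain ⟨N, hN⟩ :=
    eventually_atTop.1 (hclim.eventually (Iic_mem_nhds (by norm_num : (1 : ℝ) < 2)))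
  refine rdssTuned_exists_limit_of_le_two (α := fun n => α (n + N)) (c := fun n => c (n + N))
    (Θ := Θ) (U := fun n => U (n + N)) (P := fun n => P (n + N)) hC₀ (fun n => hc _)
    (fun n => hN _ (N.le_add_left n)) ((tendsto_add_atTop_iff_nat N).2 hclim)
    (fun n => hper _) (fun n => hcl _) (fun n => hI _) (fun n => hnt _) fun μ hμ => ?_
  obtain ⟨k, m, hk, hm⟩ := htune μ hμ
  exact ⟨fun n => k (n + N), fun n => m (n + N), (tendsto_add_atTop_iff_nat N).2 hk,
    (tendsto_add_atTop_iff_nat N).2 hm⟩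

end PineauVicol2026

end Literature.Analysis.FluidPDE
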